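import Literature.Analysis.FluidPDE.CorrectorFourierPicard
import HarnessLib

/-!
# Symmetries of the Fourier-side solution of (3.2): divergence freedom, zero mean, reality

Analysis/FluidPDE proof file, fifth of the files discharging
`Literature.Analysis.FluidPDE.Torus.CheskidovLuo2022LocalExistence` (objects in
`CorrectorFourierDefs`; Picard iteration in `CorrectorFourierPicard`). Three structural
properties are carried along the Picard iteration and passed to the limit `c = picardLim`:

* **divergence freedom on the Fourier side**, `∑ₗ kₗ c(l, t, k) = 0` (`iter_divFree`,
  `picardLim_divFree`): the Duhamel map integrates the *projected* symbol, and
  `∑ₗ kₗ (P G)ₗ = 0` (`sum_intCast_mul_projSym`);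
* **vanishing of the zero mode**, `c(l, t, 0) = 0` (`iter_zero_freq`, `picardLim_zero_freq`),
  i.e. zero spatial mean of the velocity (Cheskidov–Luo 2022, §3.1: "(3.2) preserves the
  zero-mean condition"): at `k = 0` the three transport symbols vanish for divergence-free
  drifts (`transportSym_zero_of_divFree`: `∑ⱼ∑ₘ Uⱼ(m) 2πi(-m)ⱼ c(-m) = -∑ₘ c(-m) ∑ⱼ 2πimⱼUⱼ(m)
  = 0`) and the forcing symbol `2πikⱼ` vanishes; this uses the Fourier-side divergence freedom
  of the background drift (`∑ⱼ mⱼ Uⱼ(m) = 0`, from `div u = 0`) and of `c` itself;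
* **conjugation symmetry**, `c(l, t, -k) = conj c(l, t, k)` (`iter_conjSymm`,
  `picardLim_conjSymm`), i.e. reality of the synthesized field, inherited from the real data
  (`Uⱼ(-m) = conj Uⱼ(m)`, `RHₗⱼ(-m) = conj RHₗⱼ(m)`): the lattice convolution, the derivative
  symbol (`2πi(-m)ⱼ = conj(2πimⱼ)`·(−1)… i.e. `dsym j (-m) = conj (dsym j m)`), the real even
  Leray projector and the real heat factor all commute with `k ↦ -k`, `conj`.

## References

* A. Cheskidov, X. Luo, arXiv:2009.06596, §3.1 (3.2) ("(3.2) preserves the zero-mean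
  condition"). [`CheskidovLuo2022`]
* L. Grafakos, *Classical Fourier Analysis*, 3rd ed. (2014), Prop. 3.2.5 (coefficients of real
  functions and of conjugates). [`Grafakos2014`]
-/

noncomputable section

open MeasureTheory Real Set Filter Topology UnitAddTorus

namespace Literature.Analysis.FluidPDE

namespace CorrectorFourier

open scoped ComplexConjugate
open ScalarFourier
open FourierNS (HasDecay clamp)
open Literature.Analysis.FunctionSpaces.Torus (freqNormSq)

variable {d : Type*} [Fintype d] [DecidableEq d]
variable {θ : ℝ} {U : d → ℝ → (d → ℤ) → ℂ} {RH : d → d → ℝ → (d → ℤ) → ℂ}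

/-! ### Divergence freedom on the Fourier side -/

section DivFree

/-- **The Duhamel map produces Fourier-divergence-free fields**: `∑ₗ kₗ Φ(c)(l, t, k) = 0` for
every `c` continuous in time with uniform decay of order `2#d + 1` (the integrand is the
projected symbol, `sum_intCast_mul_projSym`). [folklore] -/
theorem DataHyp.sum_intCast_mul_picardMap (h : DataHyp θ U RH) {A X : ℝ}
    (hU : ∀ j t, HasDecay (latOrder d + 1) A (U j t)) {c : d → ℝ → (d → ℤ) → ℂ}
    (hcc : ∀ l m, Continuous fun t => c l t m) (hc : ∀ l t, HasDecay (latOrder d + 1) X (c l t))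
    (t : ℝ) (k : d → ℤ) : ∑ l, (k l : ℂ) * picardMap θ U RH c l t k = 0 := by
  set τ := clamp θ t with hτdef
  have hi : ∀ l, IntervalIntegrable (fun s => (heatFactor 1 k (τ - s) : ℂ) *
      projSym (fun j => U j s) (fun i j => RH i j s) (fun j => c j s) l k) volume 0 τ := fun l =>
    (h.continuous_integrand hU hcc hc l k τ).intervalIntegrable _ _
  simp only [picardMap, ← hτdef, mul_neg, Finset.sum_neg_distrib, neg_eq_zero]
  simp_rw [← intervalIntegral.integral_const_mul]
  rw [← intervalIntegral.integral_finsetSum fun l _ => (hi l).const_mul _]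
  have hzero : ∀ s, ∑ l, (k l : ℂ) * ((heatFactor 1 k (τ - s) : ℂ) *
      projSym (fun j => U j s) (fun i j => RH i j s) (fun j => c j s) l k) = 0 := by
    intro s
    have h0 := sum_intCast_mul_projSym (fun j => U j s) (fun i j => RH i j s) (fun j => c j s) k
    calc ∑ l, (k l : ℂ) * ((heatFactor 1 k (τ - s) : ℂ) *
          projSym (fun j => U j s) (fun i j => RH i j s) (fun j => c j s) l k)
        = (heatFactor 1 k (τ - s) : ℂ) *
            ∑ l, (k l : ℂ) * projSym (fun j => U j s) (fun i j => RH i j s) (fun j => c j s) l k := by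
          rw [Finset.mul_sum]
          refine Finset.sum_congr rfl fun l _ => ?_
          ring
      _ = 0 := by rw [h0, mul_zero]
  have hfun : (fun s => ∑ l, (k l : ℂ) * ((heatFactor 1 k (τ - s) : ℂ) *
      projSym (fun j => U j s) (fun i j => RH i j s) (fun j => c j s) l k)) = fun _ => 0 :=
    funext hzero
  rw [hfun, intervalIntegral.integral_zero]

/-- **The iterates are Fourier-divergence free**: `∑ₗ kₗ cₙ(l, t, k) = 0`, given their
continuity in time and the ball bound (conclusions of `DataHyp.iter_tendsto`). [folklore] -/
theorem DataHyp.iter_divFree (h : DataHyp θ U RH) {ρ A : ℝ}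
    (hU : ∀ j t, HasDecay (latOrder d + 1) A (U j t))
    (hcont : ∀ n l m, Continuous fun t => picardIter θ U RH n l t m)
    (hball : ∀ n l t, HasDecay (latOrder d + 1) ρ (picardIter θ U RH n l t)) (n : ℕ) (t : ℝ)
    (k : d → ℤ) : ∑ l, (k l : ℂ) * picardIter θ U RH n l t k = 0 := by
  cases n with
  | zero => simp
  | succ n =>
    simp only [picardIter_succ]
    exact h.sum_intCast_mul_picardMap hU (hcont n) (hball n) t k

omit [DecidableEq d] in
/-- **The Picard limit is Fourier-divergence free**: `∑ₗ kₗ c(l, t, k) = 0`. [folklore] -/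
theorem picardLim_divFree [DecidableEq d]
    (hiter : ∀ n t k, ∑ l, (k l : ℂ) * picardIter θ U RH n l t k = 0)
    (htend : ∀ l t m, Tendsto (fun n => picardIter θ U RH n l t m) atTop (𝓝 (picardLim θ U RH l t m)))
    (t : ℝ) (k : d → ℤ) : ∑ l, (k l : ℂ) * picardLim θ U RH l t k = 0 := by
  have hlim : Tendsto (fun n => ∑ l, (k l : ℂ) * picardIter θ U RH n l t k) atTop
      (𝓝 (∑ l, (k l : ℂ) * picardLim θ U RH l t k)) :=
    tendsto_finsetSum _ fun l _ => (htend l t k).const_mul _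
  exact tendsto_nhds_unique hlim (by simp_rw [hiter]; exact tendsto_const_nhds)

omit [DecidableEq d] in
/-- The derivative symbols of a Fourier-divergence-free family vanish after summation:
`∑ⱼ 2πimⱼ cⱼ(m) = 0`. [folklore] -/
theorem sum_dsym_mul_eq_zero {c : d → (d → ℤ) → ℂ} (hc : ∀ m, ∑ j, (m j : ℂ) * c j m = 0)
    (m : d → ℤ) : ∑ j, dsym j m * c j m = 0 := by
  have h : ∑ j, dsym j m * c j m = (2 * π * Complex.I) * ∑ j, (m j : ℂ) * c j m := by
    rw [Finset.mul_sum]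
    refine Finset.sum_congr rfl fun j _ => ?_
    rw [dsym_apply]; ring
  rw [h, hc m, mul_zero]

end DivFree

/-! ### The zero mode -/

section ZeroMode

omit [DecidableEq d] in
/-- **The transport symbol vanishes at the zero frequency for a Fourier-divergence-free
drift**: `N(U, c)(0) = ∑ⱼ ∑ₘ Uⱼ(m) 2πi(-m)ⱼ c(-m) = -∑ₘ c(-m) ∑ⱼ 2πimⱼ Uⱼ(m) = 0`
(the Fourier form of `∫ (u·∇)f = 0` for `div u = 0`). [folklore] -/
theorem transportSym_zero_of_divFree {U : d → (d → ℤ) → ℂ} {c : (d → ℤ) → ℂ} {A X : ℝ}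
    (hU : ∀ j, HasDecay (latOrder d) A (U j)) (hc : HasDecay (latOrder d + 1) X c)
    (hdiv : ∀ m, ∑ j, dsym j m * U j m = 0) : transportSym U c 0 = 0 := by
  rw [transportSym_apply]
  simp_rw [lconv_apply, zero_sub]
  have hsum : ∀ j, Summable fun m => U j m * (dsym j (-m) * c (-m)) := fun j => by
    have := summable_lconv_term (g := fun m => dsym j m * c m) (hU j) (hasDecay_dsym_mul hc j).norm_le 0
    simpa only [zero_sub] using this
  rw [← Summable.tsum_finsetSum (fun j _ => hsum j)]
  have hzero : ∀ m, ∑ j, U j m * (dsym j (-m) * c (-m)) = 0 := by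
    intro m
    calc ∑ j, U j m * (dsym j (-m) * c (-m)) = -(c (-m) * ∑ j, dsym j m * U j m) := by
          rw [Finset.mul_sum, ← Finset.sum_neg_distrib]
          refine Finset.sum_congr rfl fun j _ => ?_
          rw [dsym_neg]; ring
      _ = 0 := by rw [hdiv m, mul_zero, neg_zero]
  simp_rw [hzero]
  exact tsum_zero

omit [DecidableEq d] in
/-- **The convective symbol vanishes at the zero frequency** when both the drift and the
velocity coefficients are Fourier-divergence free (the forcing symbol `2πi·0ⱼ` vanishes). [folklore] -/
theorem convSym_zero_freq {U : d → (d → ℤ) → ℂ} {RH : d → d → (d → ℤ) → ℂ} {c : d → (d → ℤ) → ℂ}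
    {A X : ℝ} (hU : ∀ j, HasDecay (latOrder d + 1) A (U j)) (hc : ∀ j, HasDecay (latOrder d + 1) X (c j))
    (hUdiv : ∀ m, ∑ j, (m j : ℂ) * U j m = 0) (hcdiv : ∀ m, ∑ j, (m j : ℂ) * c j m = 0) (l : d) :
    convSym U RH c l 0 = 0 := by
  rw [convSym_apply,
    transportSym_zero_of_divFree (fun j => (hc j).of_le (Nat.le_succ _)) (hc l) (sum_dsym_mul_eq_zero hcdiv),
    transportSym_zero_of_divFree (fun j => (hU j).of_le (Nat.le_succ _)) (hc l) (sum_dsym_mul_eq_zero hUdiv),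
    transportSym_zero_of_divFree (fun j => (hc j).of_le (Nat.le_succ _)) (hU l) (sum_dsym_mul_eq_zero hcdiv)]
  simp [dsym_apply]

/-- The projected symbol vanishes at the zero frequency under the same hypotheses. [folklore] -/
theorem projSym_zero_freq {U : d → (d → ℤ) → ℂ} {RH : d → d → (d → ℤ) → ℂ} {c : d → (d → ℤ) → ℂ}
    {A X : ℝ} (hU : ∀ j, HasDecay (latOrder d + 1) A (U j)) (hc : ∀ j, HasDecay (latOrder d + 1) X (c j))
    (hUdiv : ∀ m, ∑ j, (m j : ℂ) * U j m = 0) (hcdiv : ∀ m, ∑ j, (m j : ℂ) * c j m = 0) (l : d) :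
    projSym U RH c l 0 = 0 := by
  rw [projSym_apply]
  simp_rw [convSym_zero_freq hU hc hUdiv hcdiv, mul_zero, Finset.sum_const_zero]

/-- **The iterates have vanishing zero mode**: `cₙ(l, t, 0) = 0` (zero spatial mean of the
synthesized velocity; Cheskidov–Luo 2022, §3.1: "(3.2) preserves the zero-mean condition"),
given the Fourier-divergence freedom of the drift coefficients. [cite: CheskidovLuo2022, §3.1 (3.2)] -/
theorem DataHyp.iter_zero_freq (h : DataHyp θ U RH) {ρ A : ℝ}
    (hU : ∀ j t, HasDecay (latOrder d + 1) A (U j t))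
    (hUdiv : ∀ t m, ∑ j, (m j : ℂ) * U j t m = 0)
    (hcont : ∀ n l m, Continuous fun t => picardIter θ U RH n l t m)
    (hball : ∀ n l t, HasDecay (latOrder d + 1) ρ (picardIter θ U RH n l t)) (n : ℕ) (l : d)
    (t : ℝ) : picardIter θ U RH n l t 0 = 0 := by
  cases n with
  | zero => simp
  | succ n =>
    rw [picardIter_succ, picardMap]
    have hzero : ∀ s, projSym (fun j => U j s) (fun i j => RH i j s)
        (fun j => picardIter θ U RH n j s) l 0 = 0 := fun s =>
      projSym_zero_freq (fun j => hU j s) (fun j => hball n j s) (hUdiv s)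
        (fun m => h.iter_divFree hU hcont hball n s m) l
    simp_rw [hzero, mul_zero, intervalIntegral.integral_zero, neg_zero]

omit [DecidableEq d] in
/-- **The Picard limit has vanishing zero mode**: `c(l, t, 0) = 0`. [folklore] -/
theorem picardLim_zero_freq [DecidableEq d] (hiter : ∀ n l t, picardIter θ U RH n l t 0 = 0)
    (htend : ∀ l t m, Tendsto (fun n => picardIter θ U RH n l t m) atTop (𝓝 (picardLim θ U RH l t m)))
    (l : d) (t : ℝ) : picardLim θ U RH l t 0 = 0 :=
  tendsto_nhds_unique (htend l t 0) (by simp_rw [hiter]; exact tendsto_const_nhds)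

end ZeroMode

/-! ### Conjugation symmetry (reality) -/

section Conj

omit [Fintype d] [DecidableEq d] in
/-- `2πi(-m)ⱼ`: the derivative symbol is conjugate-odd, `conj (dsym j m) = -dsym j m`. [folklore] -/
theorem conj_dsym (j : d) (m : d → ℤ) : conj (dsym j m) = -dsym j m := by
  rw [dsym_apply]
  simp only [map_mul, map_ofNat, Complex.conj_ofReal, Complex.conj_I, map_intCast]
  ring

omit [Fintype d] [DecidableEq d] in
/-- **The lattice convolution of conjugate-symmetric sequences is conjugate symmetric**:
`(f ⋆ g)(-k) = conj ((f ⋆ g)(k))` (reindex `m ↦ -m`; no summability needed). [folklore] -/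
theorem lconv_neg_eq_conj {f g : (d → ℤ) → ℂ} (hf : ∀ m, f (-m) = conj (f m))
    (hg : ∀ m, g (-m) = conj (g m)) (k : d → ℤ) : lconv f g (-k) = conj (lconv f g k) := by
  rw [lconv_apply, lconv_apply, Complex.conj_tsum]
  rw [← (Equiv.neg (d → ℤ)).tsum_eq]
  refine tsum_congr fun m => ?_
  simp only [Equiv.neg_apply, map_mul]
  rw [hf m, show -k - -m = -(k - m) by abel, hg (k - m)]

omit [DecidableEq d] in
/-- The transport symbol of conjugate-symmetric fields is conjugate symmetric. [folklore] -/
theorem transportSym_neg_eq_conj {U : d → (d → ℤ) → ℂ} {c : (d → ℤ) → ℂ}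
    (hU : ∀ j m, U j (-m) = conj (U j m)) (hc : ∀ m, c (-m) = conj (c m)) (k : d → ℤ) :
    transportSym U c (-k) = conj (transportSym U c k) := by
  rw [transportSym_apply, transportSym_apply, map_sum]
  refine Finset.sum_congr rfl fun j _ => ?_
  refine lconv_neg_eq_conj (hU j) (fun m => ?_) k
  rw [map_mul, dsym_neg, conj_dsym, hc m]

omit [DecidableEq d] in
/-- **The convective symbol of conjugate-symmetric data and fields is conjugate symmetric.** [folklore] -/
theorem convSym_neg_eq_conj {U : d → (d → ℤ) → ℂ} {RH : d → d → (d → ℤ) → ℂ} {c : d → (d → ℤ) → ℂ}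
    (hU : ∀ j m, U j (-m) = conj (U j m)) (hR : ∀ i j m, RH i j (-m) = conj (RH i j m))
    (hc : ∀ j m, c j (-m) = conj (c j m)) (l : d) (k : d → ℤ) :
    convSym U RH c l (-k) = conj (convSym U RH c l k) := by
  rw [convSym_apply, convSym_apply, map_add, map_add, map_add, map_sum,
    transportSym_neg_eq_conj hc (hc l), transportSym_neg_eq_conj hU (hc l),
    transportSym_neg_eq_conj hc (hU l)]
  congr 1
  refine Finset.sum_congr rfl fun j _ => ?_
  rw [map_mul, dsym_neg, conj_dsym, hR l j k]

/-- The projected symbol of conjugate-symmetric data and fields is conjugate symmetric (the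
projector entries are real and even). [folklore] -/
theorem projSym_neg_eq_conj {U : d → (d → ℤ) → ℂ} {RH : d → d → (d → ℤ) → ℂ} {c : d → (d → ℤ) → ℂ}
    (hU : ∀ j m, U j (-m) = conj (U j m)) (hR : ∀ i j m, RH i j (-m) = conj (RH i j m))
    (hc : ∀ j m, c j (-m) = conj (c j m)) (l : d) (k : d → ℤ) :
    projSym U RH c l (-k) = conj (projSym U RH c l k) := by
  rw [projSym_apply, projSym_apply, map_sum]
  refine Finset.sum_congr rfl fun m _ => ?_
  rw [map_mul, leraySym_neg, conj_leraySym, convSym_neg_eq_conj hU hR hc m k]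

/-- **The Duhamel map preserves conjugation symmetry** (the heat factor is real and even in the
frequency, Mathlib `intervalIntegral_conj`). [folklore] -/
theorem picardMap_neg_eq_conj (hU : ∀ j t m, U j t (-m) = conj (U j t m))
    (hR : ∀ i j t m, RH i j t (-m) = conj (RH i j t m)) {c : d → ℝ → (d → ℤ) → ℂ}
    (hc : ∀ j t m, c j t (-m) = conj (c j t m)) (l : d) (t : ℝ) (k : d → ℤ) :
    picardMap θ U RH c l t (-k) = conj (picardMap θ U RH c l t k) := by
  simp only [picardMap]
  rw [map_neg, ← intervalIntegral.intervalIntegral_conj]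
  congr 1
  refine intervalIntegral.integral_congr fun s _ => ?_
  have hheat : heatFactor 1 (-k) (clamp θ t - s) = heatFactor 1 k (clamp θ t - s) := by
    simp [heatFactor_apply, heatRate_apply, FunctionSpaces.Torus.freqNormSq_neg]
  simp only [map_mul, Complex.conj_ofReal, hheat]
  rw [projSym_neg_eq_conj (fun j m => hU j s m) (fun i j m => hR i j s m) (fun j m => hc j s m) l k]

/-- **The iterates are conjugate symmetric**, hence so is their pointwise limit. [folklore] -/
theorem iter_conjSymm (hU : ∀ j t m, U j t (-m) = conj (U j t m))
    (hR : ∀ i j t m, RH i j t (-m) = conj (RH i j t m)) (n : ℕ) (l : d) (t : ℝ) (k : d → ℤ) :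
    picardIter θ U RH n l t (-k) = conj (picardIter θ U RH n l t k) := by
  induction n generalizing l t k with
  | zero => simp
  | succ n ih =>
    rw [picardIter_succ]
    exact picardMap_neg_eq_conj hU hR (fun j t m => ih j t m) l t k

omit [DecidableEq d] in
/-- **The Picard limit is conjugate symmetric**: `c(l, t, -k) = conj c(l, t, k)`. [folklore] -/
theorem picardLim_conjSymm [DecidableEq d] (hiter : ∀ n l t k, picardIter θ U RH n l t (-k) = conj (picardIter θ U RH n l t k))
    (htend : ∀ l t m, Tendsto (fun n => picardIter θ U RH n l t m) atTop (𝓝 (picardLim θ U RH l t m)))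
    (l : d) (t : ℝ) (k : d → ℤ) : picardLim θ U RH l t (-k) = conj (picardLim θ U RH l t k) := by
  have h1 : Tendsto (fun n => picardIter θ U RH n l t (-k)) atTop (𝓝 (conj (picardLim θ U RH l t k))) := by
    simp_rw [hiter]
    exact (Complex.continuous_conj.tendsto _).comp (htend l t k)
  exact tendsto_nhds_unique (htend l t (-k)) h1

end Conj

end CorrectorFourier

end Literature.Analysis.FluidPDE

end
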